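import Mathlib.LinearAlgebra.PerfectPairing.Basic
import Mathlib.Algebra.Module.Torsion.Basic
import Mathlib.LinearAlgebra.Quotient.Bilinear
import Mathlib.LinearAlgebra.Dimension.Finrank
import Mathlib.LinearAlgebra.FreeModule.Basic
import Mathlib.LinearAlgebra.FreeModule.PID
import Mathlib.Geometry.Manifold.ChartedSpace
import Mathlib.Analysis.InnerProductSpace.PiL2
import Literature.AlgebraicTopology.SingularHomology.CapProduct
import Literature.AlgebraicTopology.SingularHomology.FundamentalClass
import HarnessLib

-- provenance: harness21/H21/H21/Prelude/AlgTop/PoincareDuality.lean @ 83d3230 (interim HEAD d8f2665); M5 mechanical rewrite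
/-!
# Poincaré duality (trunk G04 AlgTop, item C10 `PoincareDuality`)

For a closed `R`-oriented topological `n`-manifold `X` (`[CompactSpace X] [T2Space X]
[ChartedSpace (EuclideanSpace ℝ (Fin n)) X]`, `μ : HomologicalOrientation R X n`) we define the
Poincaré duality map `D : Hᵖ(X; R) → H_q(X; R)`, `a ↦ a ⌢ [X]` (`p + q = n`), state that it is an
isomorphism (Hatcher Thm. 3.30), define the cup product pairing `(a, b) ↦ ⟨a ⌣ b, [X]⟩`, its
descent to cohomology modulo torsion, and state the nonsingularity statements
(Hatcher Prop. 3.38, Cor. 3.39), the finiteness of (co)homology of closed manifolds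
(Hatcher Cor. A.8, A.9) and the symmetry of Betti numbers.

Sources: A. Hatcher, *Algebraic Topology*, CUP 2002, §3.3 (Thm. 3.30, Prop. 3.38, Cor. 3.39) and
Appendix A (Cor. A.8, A.9, p. 527); G. Bredon, *Topology and Geometry*, GTM 139, §VI.8–VI.9.

Mathlib (pinned) has no Poincaré duality, Betti numbers or torsion-free quotient of cohomology
(searched: `poincare`, `betti`, `PoincareDual`; only `Mathlib/Geometry/Manifold/PoincareConjecture.lean`
exists, whose manifold hypotheses we reuse). From Mathlib we use `LinearMap.IsPerfPair`
(`Mathlib/LinearAlgebra/PerfectPairing/Basic.lean`), `Submodule.torsion`, `LinearMap.liftQ₂` /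
`LinearMap.liftQ₂_mk` (`Mathlib/LinearAlgebra/Quotient/Bilinear.lean`), `LinearEquiv.ofBijective`,
`Module.finrank`, `Module.Free`, `Module.Finite`.

## Conventions and design

As in `Literature.Prelude.AlgTop.SingularChains`: `X : Type u` unbundled, `R : Type v` `[CommRing R]`,
all objects in `ModuleCat.{max u v} R`; `ℤ`, `ℚ` and fields appear only by instantiation (for
statements needing a field we use a separate variable `K : Type v` `[Field K]`). The manifold
hypotheses appear on theorems (and on `poincareDualityEquiv`), not on the plain definitions
`poincareDualityMap`, `cupPairing`, `freeCohomology`, `bettiNumber`, which make sense for every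
space (with `μ.fundamentalClass` possibly the junk value `0`).

The torsion-free quotient `freeCohomology R X k = Hᵏ(X; R) / torsion` is **bundled** as an object
of `ModuleCat R` and defined once, generically in `R` (ℤ-instance discipline of the trunk outline,
§1): at `R := ℤ` typeclass search then finds `ModuleCat.isModule`, which reduces to the quotient
module structure (see the sanity `example`s below).

`LinearMap.IsPerfPair` is a class, but nonsingularity results are stated as named facts, never as
instances. **Named facts (D-0014, `Literature/` is sorry-free):** the unproved results of this file
(`bijective_poincareDualityMap`, `isPerfPair_cupPairing_of_field`, `isPerfPair_cupPairingModTorsion`,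
the two finiteness statements for `Hₖ`, `Hᵏ`, `bettiNumber_eq_bettiNumber_of_add_eq`,
`nonempty_singularCohomology_top_equiv`) are `def … : Prop` with the same binders as the printed
theorem; consumers take them as hypotheses `(h : <name> …)`. Graded symmetry of the pairings is
proved relative to the named fact `cupProduct_gradedComm R X` of `CupProduct.lean`.

## Main definitions

* `Literature.poincareDualityMap μ h : Hᵖ(X; R) →ₗ[R] H_q(X; R)`, `a ↦ a ⌢ [X]`.
* `Literature.poincareDualityEquiv μ h : Hᵖ(X; R) ≃ₗ[R] H_q(X; R)` (closed manifolds).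
* `Literature.cupPairing μ h : Hᵖ →ₗ[R] Hᵠ →ₗ[R] R`, `(a, b) ↦ ⟨a ⌣ b, [X]⟩`.
* `Literature.freeCohomology R X k : ModuleCat R`, `Hᵏ(X; R) / torsion`, with `freeCohomology.mk`.
* `Literature.cupPairingModTorsion μ h`: the cup pairing on cohomology mod torsion.
* `Literature.bettiNumber R X k : ℕ := finrank_R Hₖ(X; R)`.

## Main statements (named facts unless noted)

* `Literature.AlgebraicTopology.SingularHomology.bijective_poincareDualityMap` (Hatcher Thm. 3.30).
* `Literature.AlgebraicTopology.SingularHomology.cupPairing_flip`, `Literature.AlgebraicTopology.SingularHomology.cupPairingModTorsion_flip` (graded symmetry; proved from the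
  hypothesis `cupProduct_gradedComm R X`).
* `Literature.AlgebraicTopology.SingularHomology.isPerfPair_cupPairing_of_field` (Hatcher Prop. 3.38),
  `Literature.AlgebraicTopology.SingularHomology.isPerfPair_cupPairingModTorsion` (Hatcher Cor. 3.39 / Prop. 3.38 over a PID).
* `Literature.AlgebraicTopology.SingularHomology.bilinear_apply_eq_zero_of_mem_torsion` and the `torsion ≤ ker` corollaries (proved).
* `Literature.AlgebraicTopology.SingularHomology.finite_singularHomology_of_compactSpace`, `Literature.AlgebraicTopology.SingularHomology.finite_singularCohomology_of_compactSpace`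
  (Hatcher Cor. A.8, A.9); from the latter, `Literature.AlgebraicTopology.SingularHomology.finite_freeCohomology` and (over a PID)
  `Literature.AlgebraicTopology.SingularHomology.free_freeCohomology` are **proved**.
* `Literature.AlgebraicTopology.SingularHomology.bettiNumber_eq_bettiNumber_of_add_eq` (`b_p = b_{n-p}` over a field),
  `Literature.AlgebraicTopology.SingularHomology.nonempty_singularCohomology_top_equiv` (`Hⁿ(X; R) ≃ R`).
-/

noncomputable section

open CategoryTheory Limits Topology nonZeroDivisors

universe u v

namespace Literature.AlgebraicTopology.SingularHomology

variable {R : Type v} [CommRing R]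
variable {X : Type u} [TopologicalSpace X]

/-! ### Bilinear maps vanish on torsion -/

section Torsion

variable {V W : Type*} [AddCommGroup V] [Module R V] [AddCommGroup W] [Module R W]

/-- An `R`-bilinear map `B : V × W → R` with values in the ring itself vanishes on torsion elements
in the first slot: if `r • x = 0` with `r ∈ R⁰` a non-zero-divisor then `r * B x y = B (r • x) y = 0`
forces `B x y = 0`. No domain hypothesis is needed since `Submodule.torsion` is defined via `R⁰`
(Hatcher 2002, §3.3, p. 250, discussion before Cor. 3.39; Bourbaki, *Algèbre* II §7). [cite: Hatcher2002, §3.3  p. 250  discussion before Cor. 3.3] -/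
lemma bilinear_apply_eq_zero_of_mem_torsion (B : V →ₗ[R] W →ₗ[R] R) {x : V}
    (hx : x ∈ Submodule.torsion R V) (y : W) : B x y = 0 := by
  obtain ⟨⟨r, hr⟩, hrx⟩ := (Submodule.mem_torsion_iff x).mp hx
  have h : r * B x y = 0 := by
    rw [← smul_eq_mul, ← LinearMap.smul_apply, ← map_smul]
    change B ((⟨r, hr⟩ : R⁰) • x) y = 0
    rw [hrx, map_zero, LinearMap.zero_apply]
  exact (mem_nonZeroDivisors_iff.mp hr).1 _ h

/-- An `R`-valued `R`-bilinear map vanishes on torsion elements in the second slot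
(Hatcher 2002, §3.3, p. 250; see `bilinear_apply_eq_zero_of_mem_torsion`). [cite: Hatcher2002, §3.3  p. 250] -/
lemma bilinear_apply_eq_zero_of_mem_torsion_right (B : V →ₗ[R] W →ₗ[R] R) (x : V) {y : W}
    (hy : y ∈ Submodule.torsion R W) : B x y = 0 :=
  bilinear_apply_eq_zero_of_mem_torsion B.flip hy x

/-- The torsion submodule is contained in the (left) kernel of every `R`-valued bilinear map
(Hatcher 2002, §3.3, p. 250). [cite: Hatcher2002, §3.3  p. 250] -/
lemma torsion_le_ker_bilinear (B : V →ₗ[R] W →ₗ[R] R) :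
    Submodule.torsion R V ≤ LinearMap.ker B := fun _ hx ↦
  LinearMap.mem_ker.mpr (LinearMap.ext fun y ↦ bilinear_apply_eq_zero_of_mem_torsion B hx y)

/-- The torsion submodule is contained in the right kernel of every `R`-valued bilinear map
(Hatcher 2002, §3.3, p. 250). [cite: Hatcher2002, §3.3  p. 250] -/
lemma torsion_le_ker_bilinear_flip (B : V →ₗ[R] W →ₗ[R] R) :
    Submodule.torsion R W ≤ LinearMap.ker B.flip :=
  torsion_le_ker_bilinear B.flip

end Torsion

/-! ### The duality map -/

section Duality

variable {p q n : ℕ}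

/-- The Poincaré duality map `D : Hᵖ(X; R) → H_q(X; R)`, `D a = a ⌢ [X]`, `p + q = n`, for an
`R`-orientation `μ` with fundamental class `[X] = μ.fundamentalClass` (Hatcher 2002, §3.3,
Thm. 3.30, the map `D : Hᵏ(M; R) → H_{n-k}(M; R)`, `D(α) = [M] ⌢ α`). Defined for every space;
meaningful for closed manifolds. [cite: Hatcher2002, §3.3  Thm. 3.30  the map  D : Hᵏ(M] -/
def poincareDualityMap (μ : HomologicalOrientation R X n) (h : p + q = n) :
    singularCohomology R R X p →ₗ[R] singularHomology R R X q :=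
  (capProduct (M := R) h).flip μ.fundamentalClass

/-- `D a = a ⌢ [X]` (Hatcher 2002, §3.3, Thm. 3.30). [cite: Hatcher2002, §3.3  Thm. 3.30] -/
@[simp]
lemma poincareDualityMap_apply (μ : HomologicalOrientation R X n) (h : p + q = n)
    (a : singularCohomology R R X p) :
    poincareDualityMap μ h a = capProduct h a μ.fundamentalClass :=
  rfl

/-- **Poincaré duality.** For a closed `R`-oriented topological `n`-manifold `X`, the map
`D : Hᵖ(X; R) → H_{n-p}(X; R)`, `a ↦ a ⌢ [X]`, is an isomorphism for all `p`
(Hatcher 2002, §3.3, Thm. 3.30; Bredon, GTM 139, §VI.8, Thm. 8.3). Named fact. [cite: Hatcher2002, §3.3  Thm. 3.30] -/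
def bijective_poincareDualityMap [CompactSpace X] [T2Space X]
    [ChartedSpace (EuclideanSpace ℝ (Fin n)) X] (μ : HomologicalOrientation R X n)
    (h : p + q = n) : Prop :=
  Function.Bijective (poincareDualityMap μ h)

/-- The Poincaré duality isomorphism `Hᵖ(X; R) ≃ₗ[R] H_q(X; R)`, `p + q = n`, of a closed
`R`-oriented topological `n`-manifold (Hatcher 2002, §3.3, Thm. 3.30), built from the named fact
`hD : bijective_poincareDualityMap μ h`. [cite: Hatcher2002, §3.3  Thm. 3.30] -/
def poincareDualityEquiv [CompactSpace X] [T2Space X]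
    [ChartedSpace (EuclideanSpace ℝ (Fin n)) X] (μ : HomologicalOrientation R X n)
    (h : p + q = n) (hD : bijective_poincareDualityMap μ h) :
    singularCohomology R R X p ≃ₗ[R] singularHomology R R X q :=
  LinearEquiv.ofBijective (poincareDualityMap μ h) hD

/-- The duality isomorphism is the duality map (Hatcher 2002, §3.3, Thm. 3.30). [cite: Hatcher2002, §3.3  Thm. 3.30] -/
@[simp]
lemma poincareDualityEquiv_apply [CompactSpace X] [T2Space X]
    [ChartedSpace (EuclideanSpace ℝ (Fin n)) X] (μ : HomologicalOrientation R X n)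
    (h : p + q = n) (hD : bijective_poincareDualityMap μ h) (a : singularCohomology R R X p) :
    poincareDualityEquiv μ h hD a = poincareDualityMap μ h a :=
  rfl

/-! ### The cup product pairing -/

/-- The cup product pairing `Hᵖ(X; R) × Hᵠ(X; R) → R`, `(a, b) ↦ ⟨a ⌣ b, [X]⟩ = (a ⌣ b)[X]`,
`p + q = n` (Hatcher 2002, §3.3, p. 249, the pairing of Prop. 3.38). Defined for every space. [cite: Hatcher2002, §3.3  p. 249  the pairing of Prop. 3.38] -/
def cupPairing (μ : HomologicalOrientation R X n) (h : p + q = n) :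
    singularCohomology R R X p →ₗ[R] singularCohomology R R X q →ₗ[R] R :=
  (cupProduct h).compr₂ ((kroneckerPairing R R X n).flip μ.fundamentalClass)

/-- `cupPairing μ h a b = ⟨a ⌣ b, [X]⟩` (Hatcher 2002, §3.3, p. 249). [cite: Hatcher2002, §3.3  p. 249] -/
@[simp]
lemma cupPairing_apply (μ : HomologicalOrientation R X n) (h : p + q = n)
    (a : singularCohomology R R X p) (b : singularCohomology R R X q) :
    cupPairing μ h a b = kroneckerPairing R R X n (cupProduct h a b) μ.fundamentalClass :=
  rfl

/-- The cup pairing through the duality map: `⟨a ⌣ b, [X]⟩ = ⟨b, a ⌢ [X]⟩ = ⟨b, D a⟩`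
(Hatcher 2002, §3.3, p. 249, "`ψ([M] ⌢ φ) = (φ ⌣ ψ)[M]`"). [cite: Hatcher2002, §3.3  p. 249  " ψ( M] -/
lemma cupPairing_eq_kroneckerPairing_poincareDualityMap (μ : HomologicalOrientation R X n)
    (h : p + q = n) (a : singularCohomology R R X p) (b : singularCohomology R R X q) :
    cupPairing μ h a b = kroneckerPairing R R X q b (poincareDualityMap μ h a) := by
  rw [cupPairing_apply, poincareDualityMap_apply, kroneckerPairing_cupProduct]

/-- Graded symmetry of the cup pairing: `⟨b ⌣ a, [X]⟩ = (-1)^{pq} ⟨a ⌣ b, [X]⟩`, i.e.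
`(cupPairing μ h).flip = (-1)^{pq} • cupPairing μ h'` for `h : p + q = n`, `h' : q + p = n`
(Hatcher 2002, §3.2, Thm. 3.11 and §3.3, p. 250), from the named fact
`hc : cupProduct_gradedComm R X` (graded commutativity of `⌣`). [cite: Hatcher2002, §3.2  Thm. 3.11 and §3.3  p. 250] -/
theorem cupPairing_flip (hc : cupProduct_gradedComm R X) (μ : HomologicalOrientation R X n)
    (h : p + q = n) (h' : q + p = n) :
    (cupPairing μ h).flip = ((-1 : R) ^ (p * q)) • cupPairing μ h' := by
  ext b a
  rw [LinearMap.flip_apply, LinearMap.smul_apply, LinearMap.smul_apply, cupPairing_apply,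
    cupPairing_apply, hc h h', map_smul, LinearMap.smul_apply]

end Duality

/-! ### Nonsingularity over a field -/

section Field

variable {K : Type v} [Field K] {p q n : ℕ}

/-- **Nonsingularity of the cup pairing over a field.** For a closed `K`-oriented topological
`n`-manifold and a field `K`, the cup product pairing `Hᵖ(X; K) × H^{n-p}(X; K) → K` is perfect
(both adjoint maps are bijective) (Hatcher 2002, §3.3, Prop. 3.38 with `R` a field). Stated as a
named fact: `LinearMap.IsPerfPair` is a class, but no instance is registered. [cite: Hatcher2002, §3.3  Prop. 3.38 with  R  a field] -/
def isPerfPair_cupPairing_of_field [CompactSpace X] [T2Space X]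
    [ChartedSpace (EuclideanSpace ℝ (Fin n)) X] (μ : HomologicalOrientation K X n)
    (h : p + q = n) : Prop :=
  (cupPairing μ h).IsPerfPair

end Field

/-! ### Cohomology modulo torsion -/

section Free

variable (R X) in
/-- Singular cohomology modulo torsion, `Hᵏ(X; R) / T`, `T = Submodule.torsion R Hᵏ(X; R)`,
bundled as an object of `ModuleCat R` and defined generically in `R` (Hatcher 2002, §3.3, p. 250,
"`Hⁿ(M; ℤ)` modulo torsion", Cor. 3.39). For `R = ℤ` and `X` a closed manifold this is a
finitely generated free abelian group. [cite: Hatcher2002, §3.3  p. 250  " Hⁿ(M] -/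
def freeCohomology (k : ℕ) : ModuleCat.{max u v} R :=
  ModuleCat.of R
    (↥(singularCohomology R R X k) ⧸ Submodule.torsion R ↥(singularCohomology R R X k))

namespace freeCohomology

variable {k : ℕ}

/-- The quotient map `Hᵏ(X; R) → Hᵏ(X; R) / torsion` (Hatcher 2002, §3.3, p. 250). [cite: Hatcher2002, §3.3  p. 250] -/
def mk : singularCohomology R R X k →ₗ[R] freeCohomology R X k :=
  (Submodule.torsion R ↥(singularCohomology R R X k)).mkQ

/-- `freeCohomology.mk` is the quotient map (Hatcher 2002, §3.3, p. 250). [cite: Hatcher2002, §3.3  p. 250] -/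
lemma mk_apply (a : singularCohomology R R X k) :
    (mk a : freeCohomology R X k) = Submodule.Quotient.mk a :=
  rfl

/-- The quotient map `Hᵏ(X; R) → Hᵏ(X; R) / torsion` is surjective (Hatcher 2002, §3.3, p. 250). [cite: Hatcher2002, §3.3  p. 250] -/
lemma mk_surjective : Function.Surjective (mk : singularCohomology R R X k →ₗ[R] _) :=
  Submodule.mkQ_surjective _

/-- The kernel of `Hᵏ(X; R) → Hᵏ(X; R) / torsion` is the torsion submodule
(Hatcher 2002, §3.3, p. 250). [cite: Hatcher2002, §3.3  p. 250] -/
@[simp]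
lemma ker_mk : LinearMap.ker (mk : singularCohomology R R X k →ₗ[R] _) =
    Submodule.torsion R ↥(singularCohomology R R X k) :=
  Submodule.ker_mkQ _

/-- `mk a = 0` iff `a` is a torsion class (Hatcher 2002, §3.3, p. 250). [cite: Hatcher2002, §3.3  p. 250] -/
lemma mk_eq_zero_iff (a : singularCohomology R R X k) :
    (mk a : freeCohomology R X k) = 0 ↔ a ∈ Submodule.torsion R ↥(singularCohomology R R X k) := by
  rw [← LinearMap.mem_ker, ker_mk]

/-- Induction principle: to prove a property of all elements of `Hᵏ(X; R) / torsion` it suffices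
to prove it on images of cohomology classes (Hatcher 2002, §3.3, p. 250). [cite: Hatcher2002, §3.3  p. 250] -/
@[elab_as_elim]
theorem induction_on {C : freeCohomology R X k → Prop} (x : freeCohomology R X k)
    (h : ∀ a : singularCohomology R R X k, C (mk a)) : C x := by
  obtain ⟨a, rfl⟩ := mk_surjective x
  exact h a

end freeCohomology

/-- Sanity check (ℤ-instance discipline, trunk outline §1(iii)): at `R := ℤ` the `Module ℤ`
instance found on the carrier of `freeCohomology ℤ X k` is `ModuleCat.isModule`. -/
example (X : Type u) [TopologicalSpace X] (k : ℕ) :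
    (inferInstance : Module ℤ ↥(freeCohomology ℤ X k)) = (freeCohomology ℤ X k).isModule :=
  rfl

/-- Sanity check (ℤ-instance discipline, trunk outline §1(iii)): generic `Module ℤ` consumers
elaborate on the carrier of `freeCohomology ℤ X k`. -/
example (X : Type u) [TopologicalSpace X] (k : ℕ) :
    Module.Free ℤ ↥(freeCohomology ℤ X k) → True :=
  fun _ ↦ trivial

variable {p q n : ℕ}

/-- The cup product pairing modulo torsion,
`Hᵖ(X; R)/T × Hᵠ(X; R)/T → R`, `([a], [b]) ↦ ⟨a ⌣ b, [X]⟩`, `p + q = n`: the `R`-valued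
pairing `cupPairing μ h` vanishes on torsion in each variable and hence descends
(Hatcher 2002, §3.3, p. 250 and Cor. 3.39). Built with `LinearMap.liftQ₂`.
Relies on: `bilinear_apply_eq_zero_of_mem_torsion` (proved). [cite: Hatcher2002, §3.3  p. 250 and Cor. 3.39] -/
def cupPairingModTorsion (μ : HomologicalOrientation R X n) (h : p + q = n) :
    freeCohomology R X p →ₗ[R] freeCohomology R X q →ₗ[R] R :=
  (cupPairing μ h).liftQ₂ _ _ (torsion_le_ker_bilinear _) (torsion_le_ker_bilinear_flip _)

/-- `cupPairingModTorsion μ h [a] [b] = ⟨a ⌣ b, [X]⟩` (Hatcher 2002, §3.3, p. 250; from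
`LinearMap.liftQ₂_mk`). [cite: Hatcher2002, §3.3  p. 250] -/
@[simp]
lemma cupPairingModTorsion_mk_mk (μ : HomologicalOrientation R X n) (h : p + q = n)
    (a : singularCohomology R R X p) (b : singularCohomology R R X q) :
    cupPairingModTorsion μ h (freeCohomology.mk a) (freeCohomology.mk b) = cupPairing μ h a b :=
  rfl

/-- Graded symmetry of the cup pairing modulo torsion:
`(cupPairingModTorsion μ h).flip = (-1)^{pq} • cupPairingModTorsion μ h'`
(Hatcher 2002, §3.2, Thm. 3.11 and §3.3, p. 250), from the named fact
`hc : cupProduct_gradedComm R X`. [cite: Hatcher2002, §3.2  Thm. 3.11 and §3.3  p. 250] -/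
theorem cupPairingModTorsion_flip (hc : cupProduct_gradedComm R X) (μ : HomologicalOrientation R X n)
    (h : p + q = n) (h' : q + p = n) :
    (cupPairingModTorsion μ h).flip = ((-1 : R) ^ (p * q)) • cupPairingModTorsion μ h' := by
  ext y x
  induction x using freeCohomology.induction_on with
  | h a =>
    induction y using freeCohomology.induction_on with
    | h b =>
      rw [LinearMap.flip_apply, LinearMap.smul_apply, LinearMap.smul_apply,
        cupPairingModTorsion_mk_mk, cupPairingModTorsion_mk_mk, ← LinearMap.smul_apply,
        ← LinearMap.smul_apply, ← cupPairing_flip hc μ h h', LinearMap.flip_apply]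

/-- **Nonsingularity of the cup pairing modulo torsion.** For a closed `R`-oriented topological
`n`-manifold over a principal ideal domain `R`, the cup product pairing
`Hᵖ(X; R)/T × H^{n-p}(X; R)/T → R` is perfect (Hatcher 2002, §3.3, Prop. 3.38 and Cor. 3.39,
stated there for `R = ℤ`; the proof uses only that `R` is a PID). Named fact, not an
instance. [cite: Hatcher2002, §3.3  Prop. 3.38 and Cor. 3.39  stated t] -/
def isPerfPair_cupPairingModTorsion [IsDomain R] [IsPrincipalIdealRing R] [CompactSpace X]
    [T2Space X] [ChartedSpace (EuclideanSpace ℝ (Fin n)) X] (μ : HomologicalOrientation R X n)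
    (h : p + q = n) : Prop :=
  (cupPairingModTorsion μ h).IsPerfPair

end Free

/-! ### Finiteness and Betti numbers -/

section Finiteness

variable {n : ℕ}

variable (R X) in
/-- The homology `Hₖ(X; R)` of a closed topological manifold is a finitely generated `R`-module,
for `R` Noetherian (Hatcher 2002, Appendix A, Cor. A.8 and A.9, p. 527: a compact manifold is
homotopy equivalent to a finite CW complex, hence `Hₖ(X; ℤ)` is finitely generated; for a
Noetherian coefficient ring the same cellular argument applies). Named fact, not an
instance; `R`, `X` and the dimension `n` are explicit (usage `… R X n k`). [cite: Hatcher2002, Appendix A  Cor. A.8 and A.9  p. 527: a] -/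
def finite_singularHomology_of_compactSpace (n : ℕ) [IsNoetherianRing R] [CompactSpace X]
    [T2Space X] [ChartedSpace (EuclideanSpace ℝ (Fin n)) X] (k : ℕ) : Prop :=
  Module.Finite R (singularHomology R R X k)

variable (R X) in
/-- The cohomology `Hᵏ(X; R)` of a closed topological manifold is a finitely generated `R`-module,
for `R` Noetherian (Hatcher 2002, Appendix A, Cor. A.8 and A.9, p. 527, with the universal
coefficient theorem, §3.1, Thm. 3.2). Named fact, not an instance; `R X n` explicit. [cite: Hatcher2002, Appendix A  Cor. A.8 and A.9  p. 527  wi] -/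
def finite_singularCohomology_of_compactSpace (n : ℕ) [IsNoetherianRing R] [CompactSpace X]
    [T2Space X] [ChartedSpace (EuclideanSpace ℝ (Fin n)) X] (k : ℕ) : Prop :=
  Module.Finite R (singularCohomology R R X k)

/-- Cohomology modulo torsion `Hᵏ(X; R)/T` of a closed topological manifold is a finitely
generated `R`-module (a quotient of the finitely generated `Hᵏ(X; R)`; Hatcher 2002, Cor. A.8–A.9,
p. 527, and §3.3, p. 250).  Proved from the named fact
`finite_singularCohomology_of_compactSpace R X n k` (hypothesis `h`). [cite: Hatcher2002, §3.3 p. 250 with Cor. A.8–A.9] -/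
theorem finite_freeCohomology [IsNoetherianRing R] [CompactSpace X] [T2Space X]
    [ChartedSpace (EuclideanSpace ℝ (Fin n)) X] {k : ℕ}
    (h : finite_singularCohomology_of_compactSpace R X n k) :
    Module.Finite R (freeCohomology R X k) := by
  unfold finite_singularCohomology_of_compactSpace at h
  exact Module.Finite.quotient R _

/-- Over a principal ideal domain, cohomology modulo torsion `Hᵏ(X; R)/T` of a closed topological
manifold is a free `R`-module (finitely generated torsion-free modules over a PID are free,
Mathlib's `Module.free_of_finite_type_torsion_free'`; Hatcher 2002, §3.3, p. 250 and
Cor. A.8–A.9).  Proved from the named fact `finite_singularCohomology_of_compactSpace R X n k`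
(hypothesis `h`). [cite: Hatcher2002, §3.3 p. 250 with Cor. A.8–A.9] -/
theorem free_freeCohomology [IsDomain R] [IsPrincipalIdealRing R] [CompactSpace X] [T2Space X]
    [ChartedSpace (EuclideanSpace ℝ (Fin n)) X] {k : ℕ}
    (h : finite_singularCohomology_of_compactSpace R X n k) :
    Module.Free R (freeCohomology R X k) := by
  haveI := finite_freeCohomology h
  haveI : Module.IsTorsionFree R (freeCohomology R X k) :=
    inferInstanceAs (Module.IsTorsionFree R
      (singularCohomology R R X k ⧸ Submodule.torsion R (singularCohomology R R X k)))
  exact Module.free_of_finite_type_torsion_free'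

variable (R X) in
/-- The `k`-th Betti number of `X` with coefficients in `R`, `bₖ(X; R) = rank_R Hₖ(X; R)`, defined
as `Module.finrank R Hₖ(X; R)` (Hatcher 2002, §2.2, p. 146 for `R = ℤ`; §3.3, Cor. 3.37).
**Junk value:** `Module.finrank` is `0` whenever the module does not have a finite basis
(in particular whenever `Hₖ(X; R)` is not finitely generated); the definition is meaningful for
`R` a field (or `ℤ`) and `X` a closed manifold, where `finite_singularHomology_of_compactSpace`
applies. [cite: Hatcher2002, §2.2  p. 146 for  R = ℤ] -/
def bettiNumber (k : ℕ) : ℕ :=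
  Module.finrank R (singularHomology R R X k)

/-- **Symmetry of Betti numbers.** For a closed `K`-oriented topological `n`-manifold and a field
`K`, `b_p(X; K) = b_q(X; K)` whenever `p + q = n` (Hatcher 2002, §3.3, Cor. 3.37, via Poincaré
duality and the universal coefficient theorem over a field). Named fact, with the orientation
hypothesis and the degrees quantified inside (usage `bettiNumber_eq_bettiNumber_of_add_eq K X n`, argument
order as in `bettiNumber K X`). [cite: Hatcher2002, §3.3  Cor. 3.37  via Poincaré duality an] -/
def bettiNumber_eq_bettiNumber_of_add_eq (K : Type v) [Field K] (X : Type u) [TopologicalSpace X]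
    (n : ℕ) [CompactSpace X] [T2Space X] [ChartedSpace (EuclideanSpace ℝ (Fin n)) X] : Prop :=
  Nonempty (HomologicalOrientation K X n) →
    ∀ ⦃p q : ℕ⦄, p + q = n → bettiNumber K X p = bettiNumber K X q

variable (R X n) in
/-- For a closed connected `R`-oriented topological `n`-manifold, the top cohomology is free of
rank one: `Hⁿ(X; R) ≃ₗ[R] R` (Hatcher 2002, §3.3, Thm. 3.30 with `p = n`: `Hⁿ(X; R) ≅ H₀(X; R) ≅ R`,
`X` being path connected as a connected manifold). Named fact, with the orientation hypothesis
inside (usage `nonempty_singularCohomology_top_equiv R X n`). [cite: Hatcher2002, §3.3  Thm. 3.30 with  p = n :  Hⁿ(X] -/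
def nonempty_singularCohomology_top_equiv [CompactSpace X] [T2Space X]
    [ChartedSpace (EuclideanSpace ℝ (Fin n)) X] [ConnectedSpace X] : Prop :=
  Nonempty (HomologicalOrientation R X n) → Nonempty (singularCohomology R R X n ≃ₗ[R] R)

end Finiteness

end Literature.AlgebraicTopology.SingularHomology
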